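import Summits.Parity.GeneralizedHardyLittlewood.Theorems.GreenTaoLevelTwoMNTwoBoxCauchySchwarz

/-!
# Route `GreenTaoLevelTwo`, crux `MNTwo` (stmt-Parity-21276), line `birth`, stub `stub_mnVertical`:
# box Cauchy–Schwarz for a quadrilinear phase (GT 2008b §10, proof of Lemma 24)

Tool for block V4 / H3 (= AIF §10 Lemma 24) of the `stub_mnVertical` census (B. Green, T. Tao,
*Quadratic uniformity of the Möbius function*, Ann. Inst. Fourier 58 (2008) = arXiv:math/0606087,
§10, proof of Lemma 24: "Applying Lemma (cz) to eliminate the `b()` factors, we deduce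
`|∑ e(2(l₁−l₁')(l₂−l₂')(m₁−m₁')(m₂−m₂') φ''(st,st))| ≳ L⁴M⁴`").  Def-free corollary of
`…MNTwoBoxCauchySchwarz.box_norm_pow_sixteen_le` for the kernel `K = e(c·l₁l₂m₁m₂)`: the sixteenfold
alternating product of `K` over a box is the single phase `e(c(l₁−l₁')(l₂−l₂')(m₁−m₁')(m₂−m₂'))`.

* `box_phase_sixteen` — the sixteenfold product of `e(c l₁l₂m₁m₂)` is `e(c Δl₁Δl₂Δm₁Δm₂)`;
* `norm_pow_sixteen_quadrilinear_le` —
  `‖∑ b₁b₂b₃b₄ e(c l₁l₂m₁m₂)‖¹⁶ ≤ (N₁N₂N₃N₄)¹⁴ Re ∑₈ e(c(l₁−l₁')(l₂−l₂')(m₁−m₁')(m₂−m₂'))`.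

References: [GreenTao2008QuadraticMobius] arXiv:math/0606087 §10 (Lemma 24), App. A Lemma 38.
-/

open Finset
open scoped ComplexConjugate FourierTransform

namespace Summit.Parity.GeneralizedHardyLittlewood.GreenTaoLevelTwoMNTwoBoxPhase

open Summit.Parity.GeneralizedHardyLittlewood.GreenTaoLevelTwoMNTwoBoxCauchySchwarz
  (box_norm_pow_sixteen_le)

/-- The sixteenfold alternating product of `K = e(c l₁l₂m₁m₂)` (in the nesting of
`…MNTwoBoxCauchySchwarz.box_norm_pow_sixteen_le`) is `e(c(l₁−l₁')(l₂−l₂')(m₁−m₁')(m₂−m₂'))`.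
[cite: GreenTao2008QuadraticMobius, §10 (proof of Lemma 24)] -/
theorem box_phase_sixteen (c : ℝ) (l₁ l₁' l₂ l₂' m₁ m₁' m₂ m₂' : ℤ) :
    (((𝐞 (c * l₁ * l₂ * m₁ * m₂) : ℂ) * conj (𝐞 (c * l₁' * l₂ * m₁ * m₂) : ℂ) *
          conj ((𝐞 (c * l₁ * l₂' * m₁ * m₂) : ℂ) * conj (𝐞 (c * l₁' * l₂' * m₁ * m₂) : ℂ))) *
        conj ((𝐞 (c * l₁ * l₂ * m₁' * m₂) : ℂ) * conj (𝐞 (c * l₁' * l₂ * m₁' * m₂) : ℂ) *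
          conj ((𝐞 (c * l₁ * l₂' * m₁' * m₂) : ℂ) * conj (𝐞 (c * l₁' * l₂' * m₁' * m₂) : ℂ)))) *
      conj (((𝐞 (c * l₁ * l₂ * m₁ * m₂') : ℂ) * conj (𝐞 (c * l₁' * l₂ * m₁ * m₂') : ℂ) *
          conj ((𝐞 (c * l₁ * l₂' * m₁ * m₂') : ℂ) * conj (𝐞 (c * l₁' * l₂' * m₁ * m₂') : ℂ))) *
        conj ((𝐞 (c * l₁ * l₂ * m₁' * m₂') : ℂ) * conj (𝐞 (c * l₁' * l₂ * m₁' * m₂') : ℂ) *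
          conj ((𝐞 (c * l₁ * l₂' * m₁' * m₂') : ℂ) * conj (𝐞 (c * l₁' * l₂' * m₁' * m₂') : ℂ)))) =
      (𝐞 (c * (l₁ - l₁') * (l₂ - l₂') * (m₁ - m₁') * (m₂ - m₂')) : ℂ) := by
  -- `conj e(s) = e(−s)` and `e(x)e(y) = e(x+y)` (cf. `BoasKac.conj_fourierChar`,
  -- `CircleMethodKernel.fourierChar_coe_mul`; restated locally to keep the imports light)
  have hc : ∀ s : ℝ, conj ((𝐞 s : ℂ)) = (𝐞 (-s) : ℂ) := fun s => by
    rw [Real.fourierChar_apply, Real.fourierChar_apply, ← Complex.exp_conj, map_mul,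
      Complex.conj_ofReal, Complex.conj_I]
    congr 1; push_cast; ring
  have hm : ∀ x y : ℝ, (𝐞 x : ℂ) * (𝐞 y : ℂ) = (𝐞 (x + y) : ℂ) := fun x y => by
    rw [AddChar.map_add_eq_mul, Circle.coe_mul]
  simp only [hc, hm, neg_add_rev, neg_neg]
  congr 2
  ring

/-- **Box Cauchy–Schwarz for a quadrilinear phase.**  For `1`-bounded `b₁(l₂,m₁,m₂)`,
`b₂(l₁,m₁,m₂)`, `b₃(l₁,l₂,m₂)`, `b₄(l₁,l₂,m₁)` and finite sets `S₁, S₂, T₁, T₂ ⊂ ℤ`,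
`‖∑ b₁b₂b₃b₄ e(c l₁l₂m₁m₂)‖¹⁶ ≤ (#S₁#S₂#T₁#T₂)¹⁴ · Re ∑ e(c(l₁−l₁')(l₂−l₂')(m₁−m₁')(m₂−m₂'))`.
[cite: GreenTao2008QuadraticMobius, §10 (proof of Lemma 24), App. A Lemma 38] -/
theorem norm_pow_sixteen_quadrilinear_le (S₁ S₂ T₁ T₂ : Finset ℤ) (c : ℝ)
    (b₁ b₂ b₃ b₄ : ℤ → ℤ → ℤ → ℂ) (hb₁ : ∀ x y z, ‖b₁ x y z‖ ≤ 1) (hb₂ : ∀ x y z, ‖b₂ x y z‖ ≤ 1)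
    (hb₃ : ∀ x y z, ‖b₃ x y z‖ ≤ 1) (hb₄ : ∀ x y z, ‖b₄ x y z‖ ≤ 1) :
    ‖∑ l₁ ∈ S₁, ∑ l₂ ∈ S₂, ∑ m₁ ∈ T₁, ∑ m₂ ∈ T₂,
        b₁ l₂ m₁ m₂ * b₂ l₁ m₁ m₂ * b₃ l₁ l₂ m₂ * b₄ l₁ l₂ m₁ *
          (𝐞 (c * l₁ * l₂ * m₁ * m₂) : ℂ)‖ ^ 16 ≤
      ((#S₁ : ℝ) * #S₂ * #T₁ * #T₂) ^ 14 *
        (∑ l₁ ∈ S₁, ∑ l₁' ∈ S₁, ∑ l₂ ∈ S₂, ∑ l₂' ∈ S₂, ∑ m₁ ∈ T₁, ∑ m₁' ∈ T₁,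
          ∑ m₂ ∈ T₂, ∑ m₂' ∈ T₂,
            (𝐞 (c * (l₁ - l₁') * (l₂ - l₂') * (m₁ - m₁') * (m₂ - m₂')) : ℂ)).re := by
  have h := box_norm_pow_sixteen_le S₁ S₂ T₁ T₂ b₁ b₂ b₃ b₄ hb₁ hb₂ hb₃ hb₄
    (fun l₁ l₂ m₁ m₂ => (𝐞 (c * l₁ * l₂ * m₁ * m₂) : ℂ))
  refine h.trans (le_of_eq (congrArg (fun z : ℂ => ((#S₁ : ℝ) * #S₂ * #T₁ * #T₂) ^ 14 * z.re) ?_))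
  refine Finset.sum_congr rfl fun l₁ _ => Finset.sum_congr rfl fun l₁' _ =>
    Finset.sum_congr rfl fun l₂ _ => Finset.sum_congr rfl fun l₂' _ =>
    Finset.sum_congr rfl fun m₁ _ => Finset.sum_congr rfl fun m₁' _ =>
    Finset.sum_congr rfl fun m₂ _ => Finset.sum_congr rfl fun m₂' _ => ?_
  exact box_phase_sixteen c l₁ l₁' l₂ l₂' m₁ m₁' m₂ m₂'

end Summit.Parity.GeneralizedHardyLittlewood.GreenTaoLevelTwoMNTwoBoxPhase
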